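import Literature.AlgebraicGeometry.Resolution.ColonIdealSheafFG
import Literature.AlgebraicGeometry.Resolution.MonomialMarkedIdealsBlowup
import Mathlib.AlgebraicGeometry.IdealSheaf.Functorial
import Mathlib.AlgebraicGeometry.Noetherian
import HarnessLib

/-!
# [OURS · L1 W4.5(b) · EL♮] T-E1-CONE, piece (E-b): the schematic strict transform is supported on the
# set-theoretic strict transform

Crux `EquisingularLiftNat` = stmt-ResolutionOfSingularities-20038 (route `EquisingularLift`, chain w45b), line `sections`;
helper `--supports … --as helper` by res-L1-w45b-stub-1 (T-E1-CONE (E-b), 2026-08-27). OURS bookkeeping lemma (generic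
scheme theory); replaces the role of NOTHING in H. Hironaka's manuscript and is NOT a statement of it; AI-written,
weaker than expert review.

For a morphism `τ : X' → X` with `X'` locally Noetherian and ideal sheaves `C` (the centre) and `K` on `X`, the tree's
SCHEMATIC strict transform `strictTransformIdeal τ C K = ⨆ₙ ((K·𝒪_{X'}) : (C·𝒪_{X'})ⁿ)` (`MarkedIdeals.lean`, Görtz–Wedhorn
(13.19)) and the chain's SET-THEORETIC strict transform `closure τ⁻¹(V(K) ∖ V(C))` (`StrataSplit`, the `S'` of every EL♮
chain step) are related by

  **`support_strictTransformIdeal_subset`: `supp (strictTransformIdeal τ C K) ⊆ closure τ⁻¹(supp K ∖ supp C)`.**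

Proof: off that closed set a point `x'` has an affine neighbourhood `W` on which `V(K·𝒪) ⊆ V(C·𝒪)`, so on the Noetherian
ring `Γ(W)` the exceptional ideal lies in the radical of `K·𝒪(W)` (`Ideal.radical_eq_sInf`, reading the points of `W` as the
primes of `Γ(W)`), hence `(C·𝒪)ⁿ(W) ⊆ K·𝒪(W)` for some `n` (`Ideal.exists_pow_le_of_le_radical_of_fg`), i.e. the `n`-th colon is
the unit ideal on `W` (`ideal_colon_of_fg`, Atiyah–Macdonald 3.15) and `x' ∉ supp`. This is the set-level half of the E1 reading
«`x' ∈ supp (strict transform ideal) ⇒ x' ∈ S'`» used by T-E1-CONE (E-c); no blow-up hypothesis on `τ` is needed.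

* `le_radical_of_zeroLocus_subset` — on an affine open `W` of a scheme: `V(𝔨) ∩ W ⊆ V(𝔢)` ⇒ `𝔢 ≤ √𝔨` in `Γ(W)`;
* `ideal_colon_pow_eq_top_of_support_subset` — `supp K' ∩ W ⊆ supp E` ⇒ `(colon K' (Eⁿ))(W) = ⊤` for some `n` (`Γ(W)` Noetherian);
* `support_strictTransformIdeal_subset` — the statement above;
* (rev 2) `preimage_diff_subset_support_strictTransformIdeal`, **`support_strictTransformIdeal_eq`** — the converse inclusion
  (off the exceptional locus the colon is the total transform) and the SET EQUALITY
  `supp (strictTransformIdeal τ C K) = closure τ⁻¹(supp K ∖ supp C)`.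
References: U. Görtz, T. Wedhorn, *Algebraic Geometry I* (2nd ed.), (13.19); M. Atiyah, I. Macdonald, Cor. 3.15.
-/

set_option linter.dupNamespace false -- mandated namespace `Summit.<Summit>.<Problem>` of this single-conjunct summit

noncomputable section

open CategoryTheory AlgebraicGeometry TopologicalSpace Topology
open Literature.AlgebraicGeometry.Resolution

namespace Summit.ResolutionOfSingularities.ResolutionOfSingularities.Cruxes.EquisingularLiftNat.Sections

universe u

/-- **Points as primes**: on an affine open `W`, if every point of `W` in the zero locus of `𝔨` lies in the zero locus of `𝔢`,
then `𝔢 ≤ √𝔨` in `Γ(W)` (every prime `𝔭 ⊇ 𝔨` is the point `fromSpec 𝔭 ∈ V(𝔨) ∩ W`, hence kills `𝔢`). [folklore] -/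
theorem le_radical_of_zeroLocus_subset {Y : Scheme.{u}} {W : Y.Opens} (hW : IsAffineOpen W) (𝔨 𝔢 : Ideal Γ(Y, W))
    (h : ∀ y ∈ W, y ∈ Y.zeroLocus (U := W) 𝔨 → y ∈ Y.zeroLocus (U := W) 𝔢) : 𝔢 ≤ 𝔨.radical := by
  rw [Ideal.radical_eq_sInf]
  refine le_sInf ?_
  rintro 𝔭 ⟨h𝔨𝔭, h𝔭⟩
  -- the point `y = fromSpec 𝔭 ∈ W`
  set y : Y := hW.fromSpec ⟨𝔭, h𝔭⟩ with hy
  have hyW : y ∈ W := by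
    have h1 := Set.mem_range_self (f := fun p => hW.fromSpec p) (⟨𝔭, h𝔭⟩ : PrimeSpectrum Γ(Y, W))
    rw [hW.range_fromSpec] at h1
    exact h1
  -- `y ∈ D(f) ↔ f ∉ 𝔭`
  have hmem : ∀ f : Γ(Y, W), y ∈ Y.basicOpen f ↔ f ∉ 𝔭 := by
    intro f
    have h1 : y ∈ Y.basicOpen f ↔ (⟨𝔭, h𝔭⟩ : PrimeSpectrum Γ(Y, W)) ∈ hW.fromSpec ⁻¹ᵁ Y.basicOpen f := Iff.rfl
    rw [h1, hW.fromSpec_preimage_basicOpen]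
    exact Iff.rfl
  have hy𝔨 : y ∈ Y.zeroLocus (U := W) 𝔨 := by
    rw [Scheme.mem_zeroLocus_iff]
    intro f hf hyf
    exact (hmem f).mp hyf (h𝔨𝔭 hf)
  intro g hg
  have hy𝔢 := h y hyW hy𝔨
  rw [Scheme.mem_zeroLocus_iff] at hy𝔢
  by_contra hg𝔭
  exact hy𝔢 g hg ((hmem g).mpr hg𝔭)

/-- **If `V(K') ⊆ V(E)` on a Noetherian affine open `W`, some colon `(K' : Eⁿ)` is the unit ideal on `W`.** [folklore] -/
theorem ideal_colon_pow_eq_top_of_support_subset {Y : Scheme.{u}} [IsLocallyNoetherian Y] (K' E : Y.IdealSheafData)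
    (W : Y.affineOpens) (h : ∀ y ∈ (W : Y.Opens), y ∈ K'.support → y ∈ E.support) :
    ∃ n : ℕ, (colon K' (E ^ n)).ideal W = ⊤ := by
  haveI : IsNoetherianRing Γ(Y, W) := IsLocallyNoetherian.component_noetherian W
  have hrad : E.ideal W ≤ (K'.ideal W).radical := by
    refine le_radical_of_zeroLocus_subset W.2 _ _ fun y hyW hy => ?_
    rw [← Scheme.IdealSheafData.mem_support_iff_of_mem (I := E) (U := W) hyW]
    exact h y hyW ((Scheme.IdealSheafData.mem_support_iff_of_mem (I := K') (U := W) hyW).mpr hy)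
  obtain ⟨n, hn⟩ := Ideal.exists_pow_le_of_le_radical_of_fg hrad (IsNoetherian.noetherian _)
  refine ⟨n, ?_⟩
  have hfg : ∀ W' : Y.affineOpens, ((E ^ n).ideal W').FG := fun W' => by
    haveI : IsNoetherianRing Γ(Y, W') := IsLocallyNoetherian.component_noetherian W'
    exact IsNoetherian.noetherian _
  rw [ideal_colon_of_fg K' (E ^ n) hfg W, Scheme.IdealSheafData.ideal_pow, Pi.pow_apply, eq_top_iff]
  intro r _
  rw [Submodule.mem_colon]
  intro p hp
  rw [smul_eq_mul]
  exact Ideal.mul_mem_left _ _ (hn hp)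

/-- **The schematic strict transform is supported on the set-theoretic one**: for `τ : X' → X` with `X'` locally Noetherian and
ideal sheaves `C`, `K` on `X`, `supp (⨆ₙ ((K·𝒪_{X'}) : (C·𝒪_{X'})ⁿ)) ⊆ closure τ⁻¹(supp K ∖ supp C)`. [folklore; GW (13.19)] -/
theorem support_strictTransformIdeal_subset {X X' : Scheme.{u}} [IsLocallyNoetherian X'] (τ : X' ⟶ X)
    (C K : X.IdealSheafData) :
    ((strictTransformIdeal τ C K).support : Set X') ⊆ closure (τ ⁻¹' ((K.support : Set X) \ (C.support : Set X))) := by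
  intro x' hx'
  by_contra hZ
  -- an affine open `W ∋ x'` missing the closed set
  obtain ⟨W, hW, hxW, hWsub⟩ := exists_isAffineOpen_mem_and_subset (X := X') (x := x')
    (U := ⟨(closure (τ ⁻¹' ((K.support : Set X) \ (C.support : Set X))))ᶜ, isClosed_closure.isOpen_compl⟩) hZ
  -- on `W`: `supp (K·𝒪) ⊆ supp (C·𝒪)`
  have hsub : ∀ y ∈ W, y ∈ (K.comap τ).support → y ∈ (C.comap τ).support := by
    intro y hyW hyK
    rw [Scheme.IdealSheafData.support_comap] at hyK ⊢
    change τ y ∈ (C.support : Set X)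
    have hyK' : τ y ∈ (K.support : Set X) := hyK
    by_contra hyC
    exact hWsub hyW (subset_closure ⟨hyK', hyC⟩)
  obtain ⟨n, hn⟩ := ideal_colon_pow_eq_top_of_support_subset (K.comap τ) (C.comap τ) ⟨W, hW⟩ hsub
  -- so the `n`-th colon, hence the strict transform ideal, is the unit ideal on `W`, and `x' ∉ supp`
  have hle : colon (K.comap τ) ((C.comap τ) ^ n) ≤ strictTransformIdeal τ C K :=
    le_iSup (fun m : ℕ => colon (K.comap τ) ((C.comap τ) ^ m)) n
  have htop : (strictTransformIdeal τ C K).ideal ⟨W, hW⟩ = ⊤ := top_le_iff.mp (hn ▸ hle ⟨W, hW⟩)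
  have hz := (Scheme.IdealSheafData.mem_support_iff_of_mem (I := strictTransformIdeal τ C K) (U := ⟨W, hW⟩) hxW).mp hx'
  rw [htop, Scheme.mem_zeroLocus_iff] at hz
  exact hz 1 Submodule.mem_top (by rw [Scheme.basicOpen_one]; exact hxW)


/-! ## rev 2 (append-only): the converse inclusion and the set EQUALITY -/

/-- **Off the exceptional locus the schematic strict transform is the total transform**, so its support contains
`τ⁻¹(supp K ∖ supp C)`: for `x'` with `τ x' ∈ supp K ∖ supp C`, the stalk of the exceptional ideal is the unit ideal, every
colon `(K·𝒪 : (C·𝒪)ⁿ)_{x'}` equals `(K·𝒪)_{x'} ⊆ 𝔪_{x'}`. [folklore] -/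
theorem preimage_diff_subset_support_strictTransformIdeal {X X' : Scheme.{u}} [IsLocallyNoetherian X'] (τ : X' ⟶ X)
    (C K : X.IdealSheafData) :
    τ ⁻¹' ((K.support : Set X) \ (C.support : Set X)) ⊆ ((strictTransformIdeal τ C K).support : Set X') := by
  intro x' hx'
  obtain ⟨hK, hC⟩ := hx'
  have hC' : τ x' ∉ C.support := hC
  have hKx : x' ∈ (K.comap τ).support := by
    rw [Scheme.IdealSheafData.support_comap]
    change τ x' ∈ (K.support : Set X)
    exact hK
  have hle := (mem_support_iff_stalkIdeal_le (K.comap τ) x').mp hKx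
  rw [stalkIdeal_comap_eq_map_stalkMap] at hle
  have hst := stalkIdeal_strictTransformIdeal_of_not_mem_support (π := τ) C K hC'
  exact (mem_support_iff_stalkIdeal_le (strictTransformIdeal τ C K) x').mpr (hst ▸ hle)

/-- **The schematic and the set-theoretic strict transforms have the same support** (`X'` locally Noetherian, any `τ`, `C`, `K`):
`supp (strictTransformIdeal τ C K) = closure τ⁻¹(supp K ∖ supp C)`. [folklore; GW (13.19)] -/
theorem support_strictTransformIdeal_eq {X X' : Scheme.{u}} [IsLocallyNoetherian X'] (τ : X' ⟶ X)
    (C K : X.IdealSheafData) :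
    ((strictTransformIdeal τ C K).support : Set X') = closure (τ ⁻¹' ((K.support : Set X) \ (C.support : Set X))) :=
  Set.Subset.antisymm (support_strictTransformIdeal_subset τ C K)
    ((strictTransformIdeal τ C K).support.isClosed.closure_subset_iff.mpr
      (preimage_diff_subset_support_strictTransformIdeal τ C K))

end Summit.ResolutionOfSingularities.ResolutionOfSingularities.Cruxes.EquisingularLiftNat.Sections

end
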